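import Literature.NumberTheory.Sieve.FriedlanderIwaniecPrimes
import Literature.NumberTheory.LFunctions.PrimeSumTauberian
import Mathlib.NumberTheory.EulerProduct.Basic
import Mathlib.NumberTheory.LegendreSymbol.ZModChar
import Mathlib.Analysis.SpecialFunctions.Log.Summable
import Mathlib.Analysis.Normed.Group.Tannery
import Mathlib.Analysis.Real.Pi.Leibniz
import Mathlib.NumberTheory.SumPrimeReciprocals
import HarnessLib

/-!
# Friedlander–Iwaniec, *The polynomial `X² + Y⁴` captures its primes*: proof of the vendored input (4.8), `H = 4/π`

Trunk T-SIEVE, family `parity`. Source: J. Friedlander, H. Iwaniec, *The polynomial `X² + Y⁴`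
captures its primes*, Ann. of Math. (2) 148 (1998), 945–1040 [FriedlanderIwaniecAnnals1998], §4,
eq. (4.8): for the density `g` of (3.16) (`g(p) p = 1 + χ₄(p)(1 - 1/p)`) the constant (2.17) of the
asymptotic sieve for primes is

  `H = ∏_p (1 - g(p)) (1 - 1/p)⁻¹ = ∏_p (1 - χ₄(p) p⁻¹) = L(1, χ₄)⁻¹ = 4/π`,

the Euler product being taken in increasing order of `p` (it converges only conditionally).
`Literature.NumberTheory.Sieve.FriedlanderIwaniecPrimes` vendors this as the named fact
`Literature.Parity.FriedlanderIwaniec1998_densityConstant := fiSieveSeq.HasDensityConstant (4/π)`, one of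
the named facts from which `Literature.NumberTheory.Sieve.friedlanderIwaniecSum_isEquivalent_of_inputs` (and
`FriedlanderIwaniecPrimesInfinitude`'s `..._of_inputs'`) derive parity.S17 (FI Theorem 1). This
file DISCHARGES it:

* `Literature.Parity.FriedlanderIwaniec1998_densityConstant_holds : FriedlanderIwaniec1998_densityConstant`
  (PROVED).

## Proof

FI give no proof ("`= L(1, χ₄)⁻¹ = 4/π`"); the classical argument (Mertens 1874 for `ζ`, Landau for
`L(1, χ)`) needs (i) the Euler product for `s > 1`, (ii) the value `L(1, χ₄) = π/4` (Leibniz) and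
(iii) a passage from the Abelian limit `s → 1⁺` to the ordered partial products over `p ≤ x`, which
is the non-trivial step (it contains the convergence of `∑_p χ₄(p)/p`). We argue with real `s`
throughout and never use the analytic continuation of `L(s, χ₄)`:

1. `f_s(n) = χ₄(n) n^{-s}` is completely multiplicative (`chi4Twist s : ℕ →*₀ ℝ`), absolutely
   summable for `s > 1`, so Mathlib's `EulerProduct.eulerProduct_completely_multiplicative_hasProd`
   and `Real.hasProd_of_hasSum_log` give `exp P(s) = ∑_n f_s(n)` with
   `P(s) = ∑_p -log(1 - f_s(p))` (`exp_logEuler`).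
2. Grouping `n` in blocks of four, `∑_n f_s(n) = G(s) = ∑_k ((4k+1)^{-s} - (4k+3)^{-s})` for `s > 1`
   (`hasSum_pairTerm`); `0 ≤ (4k+1)^{-s} - (4k+3)^{-s} ≤ 4/(k+1)²` for `1 ≤ s ≤ 2` (Bernoulli),
   so by dominated convergence (Tannery, `tendsto_tsum_of_dominated_convergence`) `G(s) → G(1)` as
   `s → 1⁺`, and `G(1) = π/4` because its partial sums are the even partial sums of Leibniz's
   series (Mathlib's `Real.tendsto_sum_pi_div_four`). Hence `P(s) → log(π/4)` (`tendsto_logEuler`).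
3. `R(s) = ∑_p r_p(s)`, `r_p(s) = -log(1 - f_s(p)) - f_s(p)`, `|r_p(s)| ≤ 2 p⁻²` (`s ≥ 1`), is
   continuous at `1⁺` (Tannery again), so `T(s) = ∑_p χ₄(p) p^{-s} = P(s) - R(s) → log(π/4) - R(1)`.
4. **Tauberian step**: `|χ₄(p)| ≤ 1`, so the tree's PROVED Hardy–Littlewood–Karamata Tauberian
   theorem for prime sums `Literature.NumberTheory.LFunctions.PrimeSum.tendsto_sum_primesLE_div` (Montgomery–Vaughan,
   *Multiplicative Number Theory I*, Thm. 5.11; `Literature.NumberTheory.LFunctions.PrimeSumTauberian`)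
   converts the Abelian limit into `∑_{p ≤ x} χ₄(p)/p → log(π/4) - R(1)` (`tendsto_sum_chi4R_div`,
   Mertens' theorem for `χ₄`).
5. Adding back `∑_{p ≤ x} r_p(1) → R(1)`: `∑_{p ≤ x} -log(1 - χ₄(p)/p) → log(π/4)`, i.e.
   `∏_{p ≤ x} (1 - χ₄(p)/p) → 4/π`; and `(1 - g(p))(1 - 1/p)⁻¹ = 1 - χ₄(p)/p`
   (`one_sub_fiDensity_prime` of the statement file).

## References

* J. Friedlander, H. Iwaniec, *The polynomial `X² + Y⁴` captures its primes*, Ann. of Math. (2) 148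
  (1998), 945–1040, §4 (4.8). [FriedlanderIwaniecAnnals1998]
* H. L. Montgomery, R. C. Vaughan, *Multiplicative Number Theory I. Classical Theory*, CUP 2007,
  §5.2 Thm. 5.11 (the Tauberian theorem, as proved in the tree). [MontgomeryVaughan2007]

## Mathlib / tree

Mathlib: `ZMod.χ₄`, `ZMod.χ₄_nat_eq_if_mod_four`,
`EulerProduct.eulerProduct_completely_multiplicative_hasProd`, `Real.hasProd_of_hasSum_log`,
`Real.abs_log_sub_add_sum_range_le`, `one_add_mul_self_le_rpow_one_add` (Bernoulli),
`tendsto_tsum_of_dominated_convergence` (Tannery), `Real.tendsto_sum_pi_div_four` (Leibniz),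
`Nat.Primes.summable_rpow`, `hasSum_iff_tendsto_nat_of_nonneg`. Mathlib has the Euler product of
Dirichlet `L`-series only for `Re s > 1` (`DirichletCharacter.LSeries_eulerProduct_exp_log`) and no
evaluation of `L(1, χ₄)` (searched `pi_div_four`, `LFunction` + `χ₄`). Tree:
`Literature.NumberTheory.LFunctions.PrimeSum.tendsto_sum_primesLE_div` (`PrimeSumTauberian.lean`), `one_sub_fiDensity_prime`,
`fiSieveSeq` (`FriedlanderIwaniecPrimes.lean`).
-/

noncomputable section

open Filter Finset Real
open scoped Topology

namespace Literature.NumberTheory.Sieve.FriedlanderIwaniecPrimes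

/-! ### The character `χ₄` as a real-valued function -/

/-- `χ₄(n) ∈ ℝ` (values `0, ±1`). [folklore] -/
def chi4R (n : ℕ) : ℝ := (ZMod.χ₄ n : ℝ)

/-- `χ₄(n) = 0, 1, -1` according as `n` is even, `≡ 1`, `≡ 3 (mod 4)` (Mathlib's
`ZMod.χ₄_nat_eq_if_mod_four`). [folklore] -/
theorem chi4R_eq_ite (n : ℕ) :
    chi4R n = if n % 2 = 0 then 0 else if n % 4 = 1 then 1 else -1 := by
  unfold chi4R
  rw [ZMod.χ₄_nat_eq_if_mod_four]
  split_ifs <;> simp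

/-- `|χ₄(n)| ≤ 1`. [folklore] -/
theorem abs_chi4R_le_one (n : ℕ) : |chi4R n| ≤ 1 := by
  rw [chi4R_eq_ite]; split_ifs <;> simp

/-- `χ₄` is completely multiplicative. [folklore] -/
theorem chi4R_mul (m n : ℕ) : chi4R (m * n) = chi4R m * chi4R n := by
  simp [chi4R, Nat.cast_mul, map_mul]

/-- `χ₄(0) = 0`. [folklore] -/
theorem chi4R_zero : chi4R 0 = 0 := by simp [chi4R_eq_ite]

/-- `χ₄(1) = 1`. [folklore] -/
theorem chi4R_one : chi4R 1 = 1 := by simp [chi4R_eq_ite]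

/-- `χ₄(4k) = 0`. [folklore] -/
theorem chi4R_four_mul (k : ℕ) : chi4R (4 * k) = 0 := by
  rw [chi4R_eq_ite, if_pos (by omega)]

/-- `χ₄(4k+1) = 1`. [folklore] -/
theorem chi4R_four_mul_add_one (k : ℕ) : chi4R (4 * k + 1) = 1 := by
  rw [chi4R_eq_ite, if_neg (by omega), if_pos (by omega)]

/-- `χ₄(4k+2) = 0`. [folklore] -/
theorem chi4R_four_mul_add_two (k : ℕ) : chi4R (4 * k + 2) = 0 := by
  rw [chi4R_eq_ite, if_pos (by omega)]

/-- `χ₄(4k+3) = -1`. [folklore] -/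
theorem chi4R_four_mul_add_three (k : ℕ) : chi4R (4 * k + 3) = -1 := by
  rw [chi4R_eq_ite, if_neg (by omega), if_neg (by omega)]

/-! ### The completely multiplicative function `n ↦ χ₄(n) n^{-s}` -/

/-- `f_s(n) = χ₄(n) n^{-s}` as a monoid-with-zero homomorphism `ℕ →*₀ ℝ`. [folklore] -/
def chi4Twist (s : ℝ) : ℕ →*₀ ℝ where
  toFun n := chi4R n * (n : ℝ) ^ (-s)
  map_zero' := by simp [chi4R_zero]
  map_one' := by simp [chi4R_one]
  map_mul' m n := by
    rw [chi4R_mul, Nat.cast_mul, Real.mul_rpow (Nat.cast_nonneg m) (Nat.cast_nonneg n)]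
    ring

/-- Unfolding `f_s(n) = χ₄(n) n^{-s}`. [folklore] -/
theorem chi4Twist_apply (s : ℝ) (n : ℕ) : chi4Twist s n = chi4R n * (n : ℝ) ^ (-s) := rfl

/-- `|f_s(n)| ≤ n^{-s}`. [folklore] -/
theorem abs_chi4Twist_le (s : ℝ) (n : ℕ) : |chi4Twist s n| ≤ (n : ℝ) ^ (-s) := by
  rw [chi4Twist_apply, abs_mul, abs_of_nonneg (Real.rpow_nonneg (Nat.cast_nonneg n) _)]
  exact mul_le_of_le_one_left (Real.rpow_nonneg (Nat.cast_nonneg n) _) (abs_chi4R_le_one n)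

/-- `∑_n |f_s(n)| < ∞` for `s > 1`. [folklore] -/
theorem summable_norm_chi4Twist {s : ℝ} (hs : 1 < s) : Summable fun n => ‖chi4Twist s n‖ := by
  refine Summable.of_nonneg_of_le (fun n => norm_nonneg _) (fun n => ?_)
    (Real.summable_nat_rpow.mpr (by linarith : -s < -1))
  rw [Real.norm_eq_abs]
  exact abs_chi4Twist_le s n

/-- For a prime `p` and `s ≥ 1`, `|f_s(p)| ≤ p^{-s} ≤ 1/2`. [folklore] -/
theorem rpow_neg_le_half {p : ℕ} (hp : p.Prime) {s : ℝ} (hs : 1 ≤ s) :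
    (p : ℝ) ^ (-s) ≤ 1 / 2 := by
  have hp2 : (2 : ℝ) ≤ p := by exact_mod_cast hp.two_le
  calc (p : ℝ) ^ (-s) ≤ (p : ℝ) ^ (-1 : ℝ) :=
        Real.rpow_le_rpow_of_exponent_le (by linarith) (by linarith)
    _ = (p : ℝ)⁻¹ := Real.rpow_neg_one _
    _ ≤ 1 / 2 := by rw [one_div]; exact inv_anti₀ (by norm_num) hp2

/-- `|f_s(p)| ≤ 1/2` for `p` prime, `s ≥ 1`. [folklore] -/
theorem abs_chi4Twist_prime_le_half {p : ℕ} (hp : p.Prime) {s : ℝ} (hs : 1 ≤ s) :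
    |chi4Twist s p| ≤ 1 / 2 :=
  (abs_chi4Twist_le s p).trans (rpow_neg_le_half hp hs)

/-- `|x + log(1 - x)| ≤ 2 x²` for `|x| ≤ 1/2`. [folklore] -/
theorem abs_add_log_one_sub_le {x : ℝ} (hx : |x| ≤ 1 / 2) :
    |x + Real.log (1 - x)| ≤ 2 * x ^ 2 := by
  have h1 : |x| < 1 := by linarith
  have h := Real.abs_log_sub_add_sum_range_le h1 1
  simp only [Finset.sum_range_one, zero_add, pow_one, Nat.cast_zero, div_one] at h
  calc |x + Real.log (1 - x)| ≤ |x| ^ (1 + 1) / (1 - |x|) := h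
    _ ≤ |x| ^ 2 / (1 / 2) := by
        rw [show (1 + 1 : ℕ) = 2 from rfl]
        exact div_le_div_of_nonneg_left (by positivity) (by norm_num) (by linarith)
    _ = 2 * x ^ 2 := by rw [sq_abs]; ring

/-- The logarithmic Euler factor remainder `r_p(s) = -log(1 - f_s(p)) - f_s(p)`. [folklore] -/
def logRem (s : ℝ) (p : ℕ) : ℝ := -Real.log (1 - chi4Twist s p) - chi4Twist s p

/-- `|r_p(s)| ≤ 2 p⁻²` for `p` prime and `s ≥ 1`. [folklore] -/
theorem abs_logRem_le {p : ℕ} (hp : p.Prime) {s : ℝ} (hs : 1 ≤ s) :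
    |logRem s p| ≤ 2 * (p : ℝ) ^ (-2 : ℝ) := by
  have hx := abs_chi4Twist_prime_le_half hp hs
  have h := abs_add_log_one_sub_le hx
  have hp0 : (0 : ℝ) ≤ p := Nat.cast_nonneg p
  calc |logRem s p| = |chi4Twist s p + Real.log (1 - chi4Twist s p)| := by
        rw [logRem, ← abs_neg]; ring_nf
    _ ≤ 2 * (chi4Twist s p) ^ 2 := h
    _ ≤ 2 * ((p : ℝ) ^ (-s)) ^ 2 := by
        have h3 : (chi4Twist s p) ^ 2 ≤ ((p : ℝ) ^ (-s)) ^ 2 := by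
          rw [← sq_abs]
          exact pow_le_pow_left₀ (abs_nonneg _) (abs_chi4Twist_le s p) 2
        linarith
    _ ≤ 2 * ((p : ℝ) ^ (-1 : ℝ)) ^ 2 := by
        have hp1 : (1 : ℝ) ≤ p := by exact_mod_cast hp.one_le
        have h4 : (p : ℝ) ^ (-s) ≤ (p : ℝ) ^ (-1 : ℝ) :=
          Real.rpow_le_rpow_of_exponent_le hp1 (by linarith)
        have h5 := pow_le_pow_left₀ (Real.rpow_nonneg hp0 _) h4 2
        linarith
    _ = 2 * (p : ℝ) ^ (-2 : ℝ) := by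
        rw [Real.rpow_neg_one, Real.rpow_neg hp0, Real.rpow_two, inv_pow]

/-- `|-log(1 - f_s(p))| ≤ 3 p^{-s}` for `s ≥ 1`. [folklore] -/
theorem abs_neg_log_one_sub_chi4Twist_le {p : ℕ} (hp : p.Prime) {s : ℝ} (hs : 1 ≤ s) :
    |-Real.log (1 - chi4Twist s p)| ≤ 3 * (p : ℝ) ^ (-s) := by
  have h1 : -Real.log (1 - chi4Twist s p) = logRem s p + chi4Twist s p := by rw [logRem]; ring
  rw [h1]
  have hp0 : (0 : ℝ) ≤ p := Nat.cast_nonneg p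
  have hps : 0 ≤ (p : ℝ) ^ (-s) := Real.rpow_nonneg hp0 _
  have hhalf := rpow_neg_le_half hp hs
  calc |logRem s p + chi4Twist s p| ≤ |logRem s p| + |chi4Twist s p| := abs_add_le _ _
    _ ≤ 2 * (chi4Twist s p) ^ 2 + (p : ℝ) ^ (-s) := by
        gcongr
        · calc |logRem s p| = |chi4Twist s p + Real.log (1 - chi4Twist s p)| := by
                rw [logRem, ← abs_neg]; ring_nf
            _ ≤ 2 * (chi4Twist s p) ^ 2 :=
                abs_add_log_one_sub_le (abs_chi4Twist_prime_le_half hp hs)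
        · exact abs_chi4Twist_le s p
    _ ≤ 2 * ((p : ℝ) ^ (-s) * (1 / 2)) + (p : ℝ) ^ (-s) := by
        gcongr
        calc (chi4Twist s p) ^ 2 = |chi4Twist s p| * |chi4Twist s p| := by rw [← sq_abs, sq]
          _ ≤ (p : ℝ) ^ (-s) * (1 / 2) :=
              mul_le_mul (abs_chi4Twist_le s p) (abs_chi4Twist_prime_le_half hp hs)
                (abs_nonneg _) hps
    _ = 2 * (p : ℝ) ^ (-s) := by ring
    _ ≤ 3 * (p : ℝ) ^ (-s) := by nlinarith

/-- `1 - f_s(p) > 0` (`p` prime, `s ≥ 1`). [folklore] -/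
theorem one_sub_chi4Twist_pos {p : ℕ} (hp : p.Prime) {s : ℝ} (hs : 1 ≤ s) :
    0 < 1 - chi4Twist s p := by
  have := abs_chi4Twist_prime_le_half hp hs
  have := (abs_le.mp this).2
  linarith

/-- Summability of `-log(1 - f_s(p))` over the primes for `s > 1`. [folklore] -/
theorem summable_neg_log_one_sub_chi4Twist {s : ℝ} (hs : 1 < s) :
    Summable fun p : Nat.Primes => -Real.log (1 - chi4Twist s p) := by
  refine Summable.of_norm_bounded (g := fun p : Nat.Primes => 3 * (p : ℝ) ^ (-s)) ?_ fun p => ?_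
  · exact (Nat.Primes.summable_rpow.mpr (by linarith : -s < -1)).mul_left 3
  · rw [Real.norm_eq_abs]
    exact abs_neg_log_one_sub_chi4Twist_le p.prop hs.le

/-- `∑_p |r_p(s)| < ∞` for `s ≥ 1`. [folklore] -/
theorem summable_logRem {s : ℝ} (hs : 1 ≤ s) : Summable fun p : Nat.Primes => logRem s p := by
  refine Summable.of_norm_bounded (g := fun p : Nat.Primes => 2 * (p : ℝ) ^ (-2 : ℝ)) ?_ fun p => ?_
  · exact (Nat.Primes.summable_rpow.mpr (by norm_num)).mul_left 2
  · rw [Real.norm_eq_abs]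
    exact abs_logRem_le p.prop hs

/-- The logarithm of the Euler product, `P(s) = ∑_p -log(1 - χ₄(p) p^{-s})`. [folklore] -/
def logEuler (s : ℝ) : ℝ := ∑' p : Nat.Primes, -Real.log (1 - chi4Twist s p)

/-- **Euler product** (`s > 1`): `exp(∑_p -log(1 - χ₄(p)p^{-s})) = ∑_n χ₄(n) n^{-s}`. [folklore] -/
theorem exp_logEuler {s : ℝ} (hs : 1 < s) :
    Real.exp (logEuler s) = ∑' n : ℕ, chi4Twist s n := by
  have hprod := EulerProduct.eulerProduct_completely_multiplicative_hasProd
    (summable_norm_chi4Twist hs)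
  have hpos : ∀ p : Nat.Primes, 0 < (1 - chi4Twist s p)⁻¹ := fun p =>
    inv_pos.mpr (one_sub_chi4Twist_pos p.prop hs.le)
  have hlog : ∀ p : Nat.Primes, Real.log ((1 - chi4Twist s p)⁻¹) = -Real.log (1 - chi4Twist s p) :=
    fun p => Real.log_inv _
  have hsum : Summable fun p : Nat.Primes => Real.log ((1 - chi4Twist s p)⁻¹) := by
    simp only [hlog]; exact summable_neg_log_one_sub_chi4Twist hs
  have h2 := Real.hasProd_of_hasSum_log hpos hsum.hasSum
  have heq := HasProd.unique h2 hprod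
  rw [← heq, logEuler]
  simp only [hlog]

/-! ### The grouped series `G(s) = ∑_k ((4k+1)^{-s} - (4k+3)^{-s})`; its value `π/4` at `s = 1` -/

/-- `a^{-s} - b^{-s} ≤ 2 (b - a) / a²` for `1 ≤ a ≤ b`, `1 ≤ s ≤ 2` (Bernoulli's inequality).
[folklore] -/
theorem rpow_neg_sub_rpow_neg_le {a b s : ℝ} (ha : 1 ≤ a) (hab : a ≤ b) (hs1 : 1 ≤ s)
    (hs2 : s ≤ 2) : a ^ (-s) - b ^ (-s) ≤ 2 * (b - a) / a ^ 2 := by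
  have ha0 : 0 < a := by linarith
  have hb0 : 0 < b := by linarith
  -- `u = (b - a)/b`, `a/b = 1 - u`
  set u : ℝ := (b - a) / b with hu
  have hu0 : 0 ≤ u := div_nonneg (by linarith) hb0.le
  have hu1 : u < 1 := by rw [hu, div_lt_one hb0]; linarith
  have hab' : a / b = 1 + (-u) := by rw [hu]; field_simp; ring
  -- Bernoulli: `1 - s u ≤ (1 - u)^s = (a/b)^s`
  have hbern : 1 + s * (-u) ≤ (a / b) ^ s := by
    rw [hab']; exact one_add_mul_self_le_rpow_one_add (by linarith) hs1
  have hquot : (a / b) ^ s = a ^ s * b ^ (-s) := by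
    rw [Real.div_rpow ha0.le hb0.le, Real.rpow_neg hb0.le, div_eq_mul_inv]
  have hbs : b ^ (-s) = a ^ (-s) * (a / b) ^ s := by
    rw [hquot, ← mul_assoc, Real.rpow_neg ha0.le, inv_mul_cancel₀ (Real.rpow_pos_of_pos ha0 s).ne',
      one_mul]
  have has0 : 0 < a ^ (-s) := Real.rpow_pos_of_pos ha0 _
  have has1 : a ^ (-s) ≤ a⁻¹ := by
    rw [← Real.rpow_neg_one]
    exact Real.rpow_le_rpow_of_exponent_le ha (by linarith)
  calc a ^ (-s) - b ^ (-s) = a ^ (-s) * (1 - (a / b) ^ s) := by rw [hbs]; ring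
    _ ≤ a ^ (-s) * (s * u) := by
        apply mul_le_mul_of_nonneg_left _ has0.le
        linarith
    _ ≤ a⁻¹ * (2 * u) := by
        apply mul_le_mul has1 _ (by positivity) (by positivity)
        exact mul_le_mul_of_nonneg_right hs2 hu0
    _ ≤ a⁻¹ * (2 * ((b - a) / a)) := by
        gcongr
        rw [hu]
        exact div_le_div_of_nonneg_left (by linarith) ha0 hab
    _ = 2 * (b - a) / a ^ 2 := by field_simp

/-- The paired term `g_k(s) = (4k+1)^{-s} - (4k+3)^{-s}`. [folklore] -/
def pairTerm (k : ℕ) (s : ℝ) : ℝ :=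
  ((4 * k + 1 : ℕ) : ℝ) ^ (-s) - ((4 * k + 3 : ℕ) : ℝ) ^ (-s)

/-- `g_k(s) ≥ 0` for `s ≥ 0`. [folklore] -/
theorem pairTerm_nonneg (k : ℕ) {s : ℝ} (hs : 0 ≤ s) : 0 ≤ pairTerm k s := by
  rw [pairTerm, sub_nonneg]
  exact Real.rpow_le_rpow_of_nonpos (by positivity) (by push_cast; linarith) (by linarith)

/-- `g_k(s) ≤ 4/(k+1)²` for `1 ≤ s ≤ 2`. [folklore] -/
theorem pairTerm_le (k : ℕ) {s : ℝ} (hs1 : 1 ≤ s) (hs2 : s ≤ 2) :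
    pairTerm k s ≤ 4 / ((k : ℝ) + 1) ^ 2 := by
  have h := rpow_neg_sub_rpow_neg_le (a := ((4 * k + 1 : ℕ) : ℝ)) (b := ((4 * k + 3 : ℕ) : ℝ))
    (by push_cast; linarith [(Nat.cast_nonneg k : (0 : ℝ) ≤ k)]) (by push_cast; linarith) hs1 hs2
  rw [pairTerm]
  refine h.trans ?_
  have hk : (0 : ℝ) ≤ k := Nat.cast_nonneg k
  push_cast
  rw [show (4 * (k : ℝ) + 3 - (4 * k + 1)) = 2 by ring,
    div_le_div_iff₀ (by positivity) (by positivity)]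
  nlinarith

/-- `|g_k(s)| ≤ 4/(k+1)²` for `1 ≤ s ≤ 2`. [folklore] -/
theorem abs_pairTerm_le (k : ℕ) {s : ℝ} (hs1 : 1 ≤ s) (hs2 : s ≤ 2) :
    |pairTerm k s| ≤ 4 / ((k : ℝ) + 1) ^ 2 := by
  rw [abs_of_nonneg (pairTerm_nonneg k (by linarith))]
  exact pairTerm_le k hs1 hs2

/-- `∑_k 4/(k+1)² < ∞`. [folklore] -/
theorem summable_pairTerm_bound : Summable fun k : ℕ => 4 / ((k : ℝ) + 1) ^ 2 := by
  have h : Summable fun k : ℕ => ((((k + 1 : ℕ) : ℝ)) ^ 2)⁻¹ :=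
    (summable_nat_add_iff 1).mpr (Real.summable_nat_pow_inv.mpr one_lt_two)
  have heq : (fun k : ℕ => 4 / ((k : ℝ) + 1) ^ 2) =
      fun k : ℕ => 4 * ((((k + 1 : ℕ) : ℝ)) ^ 2)⁻¹ := by
    funext k; push_cast; ring
  rw [heq]
  exact h.mul_left 4

/-- Grouping the Dirichlet series in blocks of four: `∑_{n < 4K} χ₄(n) n^{-s} = ∑_{k < K} g_k(s)`.
[folklore] -/
theorem sum_range_four_mul_chi4Twist (s : ℝ) (K : ℕ) :
    ∑ n ∈ range (4 * K), chi4Twist s n = ∑ k ∈ range K, pairTerm k s := by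
  induction K with
  | zero => simp
  | succ K ih =>
    rw [show 4 * (K + 1) = 4 * K + 1 + 1 + 1 + 1 by ring, sum_range_succ, sum_range_succ,
      sum_range_succ, sum_range_succ, ih, sum_range_succ]
    have h0 : chi4Twist s (4 * K) = 0 := by rw [chi4Twist_apply, chi4R_four_mul, zero_mul]
    have h1 : chi4Twist s (4 * K + 1) = ((4 * K + 1 : ℕ) : ℝ) ^ (-s) := by
      rw [chi4Twist_apply, chi4R_four_mul_add_one, one_mul]
    have h2 : chi4Twist s (4 * K + 1 + 1) = 0 := by
      rw [show 4 * K + 1 + 1 = 4 * K + 2 by ring, chi4Twist_apply, chi4R_four_mul_add_two, zero_mul]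
    have h3 : chi4Twist s (4 * K + 1 + 1 + 1) = -((4 * K + 3 : ℕ) : ℝ) ^ (-s) := by
      rw [show 4 * K + 1 + 1 + 1 = 4 * K + 3 by ring, chi4Twist_apply, chi4R_four_mul_add_three]
      ring
    rw [h0, h1, h2, h3, pairTerm]
    ring

/-- For `s > 1`, `∑_n χ₄(n) n^{-s} = ∑_k g_k(s)` (as a `HasSum`). [folklore] -/
theorem hasSum_pairTerm {s : ℝ} (hs : 1 < s) :
    HasSum (fun k => pairTerm k s) (∑' n : ℕ, chi4Twist s n) := by
  rw [hasSum_iff_tendsto_nat_of_nonneg (fun k => pairTerm_nonneg k (by linarith))]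
  have h := (summable_norm_chi4Twist hs).of_norm.hasSum.tendsto_sum_nat
  have h4 : Tendsto (fun K : ℕ => 4 * K) atTop atTop :=
    tendsto_atTop_mono (fun K => show K ≤ _ by omega) tendsto_id
  refine (h.comp h4).congr fun K => ?_
  simp only [Function.comp_def]
  exact sum_range_four_mul_chi4Twist s K

/-- For `s > 1`, `∑_n χ₄(n) n^{-s} = G(s)`. [folklore] -/
theorem tsum_chi4Twist_eq {s : ℝ} (hs : 1 < s) :
    ∑' n : ℕ, chi4Twist s n = ∑' k : ℕ, pairTerm k s :=
  (hasSum_pairTerm hs).tsum_eq.symm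

/-- The partial sums of `∑_k g_k(1)` are the even partial sums of Leibniz's series. [folklore] -/
theorem sum_range_pairTerm_one (K : ℕ) :
    ∑ k ∈ range K, pairTerm k 1 = ∑ i ∈ range (2 * K), (-1 : ℝ) ^ i / (2 * i + 1) := by
  induction K with
  | zero => simp
  | succ K ih =>
    rw [sum_range_succ, ih, show 2 * (K + 1) = 2 * K + 1 + 1 by ring, sum_range_succ,
      sum_range_succ, pairTerm, Real.rpow_neg_one, Real.rpow_neg_one, pow_succ, pow_mul]
    push_cast
    norm_num
    ring

/-- `∑_k ((4k+1)⁻¹ - (4k+3)⁻¹) = π/4` (Leibniz). [folklore] -/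
theorem hasSum_pairTerm_one : HasSum (fun k => pairTerm k 1) (π / 4) := by
  rw [hasSum_iff_tendsto_nat_of_nonneg (fun k => pairTerm_nonneg k zero_le_one)]
  have h2 : Tendsto (fun K : ℕ => 2 * K) atTop atTop :=
    tendsto_atTop_mono (fun K => show K ≤ _ by omega) tendsto_id
  refine (Real.tendsto_sum_pi_div_four.comp h2).congr fun K => ?_
  simp only [Function.comp_def]
  exact (sum_range_pairTerm_one K).symm

/-- `G(1) = π/4`. [folklore] -/
theorem tsum_pairTerm_one : ∑' k : ℕ, pairTerm k 1 = π / 4 := hasSum_pairTerm_one.tsum_eq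

/-- Each `g_k` is continuous in `s`. [folklore] -/
theorem continuousAt_pairTerm (k : ℕ) (s₀ : ℝ) : ContinuousAt (fun s => pairTerm k s) s₀ := by
  unfold pairTerm
  refine ContinuousAt.sub ?_ ?_
  · exact (Real.continuousAt_const_rpow (by positivity)).comp (continuousAt_neg)
  · exact (Real.continuousAt_const_rpow (by positivity)).comp (continuousAt_neg)

/-- `G(s) → G(1) = π/4` as `s → 1⁺` (dominated convergence with the bound `4/(k+1)²`). [folklore] -/
theorem tendsto_tsum_pairTerm :
    Tendsto (fun s : ℝ => ∑' k : ℕ, pairTerm k s) (𝓝[>] 1) (𝓝 (π / 4)) := by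
  rw [← tsum_pairTerm_one]
  refine tendsto_tsum_of_dominated_convergence summable_pairTerm_bound (fun k => ?_) ?_
  · exact tendsto_nhdsWithin_of_tendsto_nhds (continuousAt_pairTerm k 1).tendsto
  · filter_upwards [Ioo_mem_nhdsGT (show (1 : ℝ) < 2 by norm_num)] with s hs k
    rw [Real.norm_eq_abs]
    exact abs_pairTerm_le k hs.1.le hs.2.le

/-- `∑_n χ₄(n) n^{-s} → π/4` as `s → 1⁺`. [folklore] -/
theorem tendsto_tsum_chi4Twist :
    Tendsto (fun s : ℝ => ∑' n : ℕ, chi4Twist s n) (𝓝[>] 1) (𝓝 (π / 4)) := by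
  refine tendsto_tsum_pairTerm.congr' ?_
  filter_upwards [self_mem_nhdsWithin] with s hs
  exact (tsum_chi4Twist_eq hs).symm

/-- `P(s) = ∑_p -log(1 - χ₄(p) p^{-s}) → log(π/4)` as `s → 1⁺`. [folklore] -/
theorem tendsto_logEuler : Tendsto logEuler (𝓝[>] 1) (𝓝 (Real.log (π / 4))) := by
  have hlog := (Real.continuousAt_log (ne_of_gt (by positivity : (0 : ℝ) < π / 4))).tendsto.comp
    tendsto_tsum_chi4Twist
  refine hlog.congr' ?_
  filter_upwards [self_mem_nhdsWithin] with s hs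
  simp only [Function.comp_def]
  rw [← exp_logEuler hs, Real.log_exp]

/-! ### The remainder `R(s) = ∑_p r_p(s)` is continuous at `s = 1⁺` -/

/-- `s ↦ f_s(p)` is continuous (`p ≠ 0`). [folklore] -/
theorem continuousAt_chi4Twist (p : ℕ) (hp : p ≠ 0) (s₀ : ℝ) :
    ContinuousAt (fun s => chi4Twist s p) s₀ := by
  simp only [chi4Twist_apply]
  exact continuousAt_const.mul
    ((Real.continuousAt_const_rpow (by exact_mod_cast hp)).comp continuousAt_neg)

/-- `s ↦ r_p(s)` is continuous at `s = 1` (`p` prime). [folklore] -/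
theorem continuousAt_logRem {p : ℕ} (hp : p.Prime) : ContinuousAt (fun s => logRem s p) 1 := by
  unfold logRem
  have hc := continuousAt_chi4Twist p hp.ne_zero 1
  refine ContinuousAt.sub (ContinuousAt.neg ?_) hc
  have hpos : 1 - chi4Twist 1 p ≠ 0 := (one_sub_chi4Twist_pos hp le_rfl).ne'
  have hf : ContinuousAt (fun s : ℝ => 1 - chi4Twist s p) 1 := continuousAt_const.sub hc
  exact ContinuousAt.comp (g := Real.log) (Real.continuousAt_log hpos) hf

/-- `R(s) → R(1)` as `s → 1⁺` (dominated convergence with the bound `2 p⁻²`). [folklore] -/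
theorem tendsto_tsum_logRem :
    Tendsto (fun s : ℝ => ∑' p : Nat.Primes, logRem s p) (𝓝[>] 1)
      (𝓝 (∑' p : Nat.Primes, logRem 1 p)) := by
  refine tendsto_tsum_of_dominated_convergence
    ((Nat.Primes.summable_rpow.mpr (by norm_num : (-2 : ℝ) < -1)).mul_left 2) (fun p => ?_) ?_
  · exact tendsto_nhdsWithin_of_tendsto_nhds (continuousAt_logRem p.prop).tendsto
  · filter_upwards [self_mem_nhdsWithin] with s (hs : 1 < s) p
    rw [Real.norm_eq_abs]
    exact abs_logRem_le p.prop hs.le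

/-! ### The prime Dirichlet series `T(s) = ∑_p χ₄(p) p^{-s}` and the Tauberian step -/

/-- `T(s) = P(s) - R(s)` for `s > 1`. [folklore] -/
theorem tsum_chi4Twist_primes_eq {s : ℝ} (hs : 1 < s) :
    ∑' p : Nat.Primes, chi4Twist s p = logEuler s - ∑' p : Nat.Primes, logRem s p := by
  rw [logEuler, ← Summable.tsum_sub (summable_neg_log_one_sub_chi4Twist hs) (summable_logRem hs.le)]
  refine tsum_congr fun p => ?_
  rw [logRem]; ring

/-- `T(s) → log(π/4) - R(1)` as `s → 1⁺`. [folklore] -/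
theorem tendsto_tsum_chi4Twist_primes :
    Tendsto (fun s : ℝ => ∑' p : Nat.Primes, chi4R p * (p : ℝ) ^ (-s)) (𝓝[>] 1)
      (𝓝 (Real.log (π / 4) - ∑' p : Nat.Primes, logRem 1 p)) := by
  refine (tendsto_logEuler.sub tendsto_tsum_logRem).congr' ?_
  filter_upwards [self_mem_nhdsWithin] with s (hs : 1 < s)
  rw [← tsum_chi4Twist_primes_eq hs]
  rfl

/-- **Mertens' theorem for `χ₄`** (via the tree's Tauberian theorem for prime sums,
Montgomery–Vaughan Thm. 5.11): `∑_{p ≤ x} χ₄(p)/p` converges, to `log(π/4) - R(1)`. [folklore] -/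
theorem tendsto_sum_chi4R_div :
    Tendsto (fun x : ℕ => ∑ p ∈ Nat.primesLE x, chi4R p / p) atTop
      (𝓝 (Real.log (π / 4) - ∑' p : Nat.Primes, logRem 1 p)) :=
  Literature.NumberTheory.LFunctions.PrimeSum.tendsto_sum_primesLE_div (B := 1) (fun p _ => abs_chi4R_le_one p)
    tendsto_tsum_chi4Twist_primes

/-- Partial sums over `p ≤ n` of a function summable over the primes tend to its sum. [folklore] -/
theorem tendsto_sum_primesLE_of_summable {F : ℕ → ℝ} (hF : Summable fun p : Nat.Primes => F p) :
    Tendsto (fun n => ∑ p ∈ Nat.primesLE n, F p) atTop (𝓝 (∑' p : Nat.Primes, F p)) := by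
  have h1 : ∑' p : Nat.Primes, F p = ∑' n : ℕ, {p : ℕ | p.Prime}.indicator F n :=
    tsum_subtype {p : ℕ | p.Prime} F
  have h2 : Summable ({p : ℕ | p.Prime}.indicator F) := summable_subtype_iff_indicator.mp hF
  rw [h1]
  refine ((h2.hasSum.tendsto_sum_nat).comp (tendsto_add_atTop_nat 1)).congr fun n => ?_
  simp only [Function.comp_def]
  rw [Nat.primesLE, Nat.primesBelow, Finset.sum_filter]
  refine Finset.sum_congr rfl fun k _ => ?_
  by_cases hk : k.Prime <;> simp [hk]

/-- `∑_{p ≤ x} -log(1 - χ₄(p)/p) → log(π/4)`. [folklore] -/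
theorem tendsto_sum_neg_log :
    Tendsto (fun x : ℕ => ∑ p ∈ Nat.primesLE x, -Real.log (1 - chi4R p / p)) atTop
      (𝓝 (Real.log (π / 4))) := by
  have h := tendsto_sum_chi4R_div.add (tendsto_sum_primesLE_of_summable (summable_logRem le_rfl))
  rw [sub_add_cancel] at h
  refine h.congr fun x => ?_
  rw [← sum_add_distrib]
  refine sum_congr rfl fun p _ => ?_
  have h1 : chi4Twist 1 p = chi4R p / p := by
    rw [chi4Twist_apply, Real.rpow_neg_one, div_eq_mul_inv]
  rw [logRem, h1]
  ring

/-! ### (4.8): `∏_{p ≤ x} (1 - g(p))(1 - 1/p)⁻¹ = ∏_{p ≤ x} (1 - χ₄(p)/p) → 4/π` -/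

/-- The factor of (4.8): `(1 - g(p)) (1 - 1/p)⁻¹ = 1 - χ₄(p)/p`.
[cite: FriedlanderIwaniecAnnals1998, (4.8)] -/
theorem densityFactor_eq {p : ℕ} (hp : p.Prime) :
    (1 - fiDensity p) / (1 - (p : ℝ)⁻¹) = 1 - chi4R p / p := by
  rw [one_sub_fiDensity_prime hp]
  have hp1 : (1 : ℝ) < p := by exact_mod_cast hp.one_lt
  have hne : (1 : ℝ) - (p : ℝ)⁻¹ ≠ 0 := sub_ne_zero.mpr (ne_of_gt (inv_lt_one_of_one_lt₀ hp1))
  rw [mul_div_cancel_left₀ _ hne, chi4R, div_eq_mul_inv]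

/-- `1 - χ₄(p)/p > 0`. [folklore] -/
theorem one_sub_chi4R_div_pos {p : ℕ} (hp : p.Prime) : 0 < 1 - chi4R p / p := by
  have h := one_sub_chi4Twist_pos hp le_rfl
  rwa [chi4Twist_apply, Real.rpow_neg_one, ← div_eq_mul_inv] at h

/-- `∏_{p ≤ x} (1 - g(p))(1 - 1/p)⁻¹ = exp(-∑_{p ≤ x} -log(1 - χ₄(p)/p))`. [folklore] -/
theorem prod_densityFactor_eq (x : ℕ) :
    ∏ p ∈ Nat.primesLE x, (1 - fiDensity p) / (1 - (p : ℝ)⁻¹) =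
      Real.exp (-∑ p ∈ Nat.primesLE x, -Real.log (1 - chi4R p / p)) := by
  rw [← sum_neg_distrib, Real.exp_sum]
  refine prod_congr rfl fun p hp => ?_
  have hp' : p.Prime := (Nat.mem_primesLE.mp hp).2
  rw [neg_neg, Real.exp_log (one_sub_chi4R_div_pos hp'), densityFactor_eq hp']

/-- **FI (4.8), discharged**: `H = ∏_p (1 - g(p))(1 - 1/p)⁻¹ = ∏_p (1 - χ₄(p)/p) = 4/π`, the
Euler product at `s = 1` in increasing order of `p`. Proof: Euler product for `s > 1`
(`∑_n χ₄(n) n^{-s} = ∏_p (1 - χ₄(p)p^{-s})⁻¹`), the value `∑_n χ₄(n)/n = π/4` (Leibniz) reached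
as `s → 1⁺` by grouping the series in blocks of four, and the Hardy–Littlewood–Karamata
Tauberian theorem for prime sums (Montgomery–Vaughan Thm. 5.11, the tree's
`Literature.NumberTheory.LFunctions.PrimeSum.tendsto_sum_primesLE_div`) to pass from `∑_p χ₄(p) p^{-s}` (`s → 1⁺`) to the
ordered sum `∑_{p ≤ x} χ₄(p)/p`. [cite: FriedlanderIwaniecAnnals1998, (4.8)] -/
theorem _root_.Literature.NumberTheory.Sieve.FriedlanderIwaniec1998_densityConstant_holds :
    FriedlanderIwaniec1998_densityConstant := by
  unfold FriedlanderIwaniec1998_densityConstant SieveSequence.HasDensityConstant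
  show Tendsto (fun x : ℕ => ∏ p ∈ Nat.primesLE x, (1 - fiDensity p) / (1 - (p : ℝ)⁻¹)) atTop
    (𝓝 (4 / Real.pi))
  simp only [prod_densityFactor_eq]
  have h := (Real.continuous_exp.tendsto _).comp tendsto_sum_neg_log.neg
  have hval : Real.exp (-Real.log (π / 4)) = 4 / π := by
    rw [Real.exp_neg, Real.exp_log (by positivity), inv_div]
  rw [hval] at h
  exact h

end Literature.NumberTheory.Sieve.FriedlanderIwaniecPrimes
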